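import Summits.QuantumFields.BalabanUV.T4Continuum.Support.UrsellMayerRooted

/-!
# NE5 ∕ U3, route P2 — R-IDENT part (A2): MAYER'S THEOREM for a finite hard-core polymer system — the Kotecký–Preiss
# continuous-branch logarithm `polymerLogZ` IS the ordered Ursell series wherever the latter converges absolutely

Cell `pub-balaban`, unit `b2b-balaban-t4-ne5-p2` (T⁴ fan-out NE5 ∕ node U3, PROVER seat P2 «polymer-activity Lipschitz ∕
Kotecký–Preiss route», lineage gen 18; journal CLAIM «R-IDENT»).  Summits-side new work under the LEAN PLACEMENT RULE (our generic
bridge lemmas; NOT a Literature module, NOT a statement about any Bałaban paper).  HONEST FRAMING: rung (B)+1 of the FINITE-VOLUME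
T⁴ continuum programme — NOT infinite volume, NOT a mass gap, NOT the Clay problem, NOT a proof of NE5.  HONEST DEPENDENCY (cell
line, verbatim): continuum YM on T⁴ ⇐ BetaPertH ∧ nine spine estimates (0/9 proved); BetaPertH ⇐ (D1) ∧ (D4) ∧ CAP+tail; G-an2-4
gates asym, D1 and NE2/3/4.

WHAT.  For a finite polymer type `β`, a reflexive symmetric hard core `inc` and activities `w : β → ℂ`, with the vocabulary of
`Support/UrsellMayerSeries` (`U inc w n = Σ_{Z : Fin n → β} ρᵀ(Z)·Π w(Z m)`, `zc`, …):
* §1 `Uabs` (the absolute level sums `Σ_Z |ρᵀ(Z)|·Π ‖w(Z m)‖`), the Mayer coefficients `mayerCoeff n = U n ∕ n!`, the HYPOTHESIS of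
  the file `Summable (n ↦ Uabs (n+1) ∕ (n+1)!)` (absolute convergence of the ordered series, displayed inline in every theorem — the
  currency in which the tree-graph bounds `UrsellSeriesBound` ∕ `TreeGraphSummation` are stated; no `def … : Prop` is minted), and the Mayer function `mayerF z = Σ' c_{n+1} z^{n+1}`
  on the closed unit disc (continuous there, holomorphic inside, termwise derivative — Mathlib's locally uniform limits);
* §2 `Z′ = F′·Z` on `[0,1)`: the Cauchy product of the derivative series with the (polynomial) partition function along the ray
  `t•w`, term by term the convolution identity `succ_mul_zc_succ` of (A1);
* §3 **`cexp_mayerF_eq_polymerPartitionFunction`**: `exp(F(t)) = Z(univ; t•w)` for `t ∈ [0,1]` (so `Z ≠ 0` on the segment), and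
  **MAYER'S THEOREM `polymerLogZ_eq_tsum`**: `polymerLogZ inc w univ = Σ' n, U (n+1) ∕ (n+1)!` (`HasSum` form `hasSum_polymerLogZ`) —
  the tree's Kotecký–Preiss logarithm `∫₀¹ Z′∕Z` ([KP86] §2's continuous branch, `Literature.Probability.LatticeModels.polymerLogZ`)
  equals the ordered Ursell ∕ Mayer series (Friedli–Velenik Prop. 5.3 ∕ (5.10)'s left side) under absolute convergence;
* §4 TRANSPORT to a finite SET `K : Finset α` of polymers of any type (the form the consumers use: tuples in
  `Fintype.piFinset (fun _ : Fin n => K)`): **`polymerLogZ_finset_eq_tsum`**.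
No smallness is assumed beyond the displayed absolute convergence; no Bałaban object.  0 sorry; axioms ⊆ {propext, Classical.choice,
Quot.sound}.  References (FORM only): Friedli–Velenik, *Statistical Mechanics of Lattice Systems* (CUP 2017) §5.3–§5.4; Ruelle 1969
§4.4; Kotecký–Preiss, CMP 103 (1986) §2.
-/

noncomputable section

open Finset Filter Topology
open scoped BigOperators

namespace Summit.QuantumFields.BalabanUV.T4Continuum.UrsellMayerSeries

open Literature.Probability.LatticeModels (IsCompatible hcUrsell polymerPartitionFunction polymerRayDeriv polymerLogZ
  polymerPartitionFunction_zero_mul hasDerivAt_polymerPartitionFunction_ray continuous_polymerPartitionFunction_ray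
  continuousOn_polymerLogZ_integrand polymerLogZ_image)

variable {β : Type*} [Fintype β] (inc : β → β → Prop) [DecidableRel inc] (w : β → ℂ)

/-! ## §1 Absolute level sums, the hypothesis shape, the Mayer function -/

/-- [folklore] THE ABSOLUTE LEVEL SUM `Σ_{Z : Fin n → β} |ρᵀ(Z)|·Π_m ‖w(Z m)‖`. -/
def Uabs (n : ℕ) : ℝ := ∑ Z : Fin n → β, |(ursT inc Z : ℝ)| * ∏ m, ‖w (Z m)‖

/-- [folklore] The absolute level sums are nonnegative. -/
theorem Uabs_nonneg (n : ℕ) : 0 ≤ Uabs inc w n :=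
  Finset.sum_nonneg fun _ _ => mul_nonneg (abs_nonneg _) (Finset.prod_nonneg fun _ _ => norm_nonneg _)

/-- [folklore] `‖U n‖ ≤ Uabs n`. -/
theorem norm_U_le_Uabs (n : ℕ) : ‖U inc w n‖ ≤ Uabs inc w n := by
  unfold U Uabs
  refine (norm_sum_le _ _).trans (Finset.sum_le_sum fun Z _ => ?_)
  rw [norm_mul, Complex.norm_intCast, norm_prod]

/-- [folklore] THE MAYER COEFFICIENT `c_n := U n ∕ n!` (level `n` of the ordered Ursell series with its `1∕n!`). -/
def mayerCoeff (n : ℕ) : ℂ := U inc w n / (n.factorial : ℂ)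

/-- [folklore] `‖c_n‖ ≤ Uabs n ∕ n!`. -/
theorem norm_mayerCoeff_le (n : ℕ) : ‖mayerCoeff inc w n‖ ≤ Uabs inc w n / (n.factorial : ℝ) := by
  unfold mayerCoeff
  rw [norm_div, Complex.norm_natCast]
  exact div_le_div_of_nonneg_right (norm_U_le_Uabs inc w n) (Nat.cast_nonneg _)

variable {inc w}

/-- [folklore] Under absolute convergence of the ordered series (`Σ_n Uabs (n+1)∕(n+1)! < ∞` — the HYPOTHESIS of this
file, in the currency of the tree-graph bounds; no smallness hidden) the Mayer coefficients are absolutely summable. -/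
theorem summable_norm_mayerCoeff (h : Summable fun n => Uabs inc w (n + 1) / ((n + 1).factorial : ℝ)) : Summable fun n => ‖mayerCoeff inc w (n + 1)‖ :=
  Summable.of_nonneg_of_le (fun _ => norm_nonneg _) (fun n => norm_mayerCoeff_le inc w (n + 1)) h

variable (inc w)

/-- [folklore] THE MAYER FUNCTION along the activity ray: `F(z) := Σ' n, c_{n+1}·z^{n+1}` (junk where not summable). -/
def mayerF (z : ℂ) : ℂ := ∑' n, mayerCoeff inc w (n + 1) * z ^ (n + 1)

/-- [folklore] `F(0) = 0`. -/
theorem mayerF_zero : mayerF inc w 0 = 0 := by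
  unfold mayerF
  simp

/-- [folklore] `F(1) = Σ' n, c_{n+1}`. -/
theorem mayerF_one : mayerF inc w 1 = ∑' n, mayerCoeff inc w (n + 1) := by
  unfold mayerF
  simp

variable {inc w}

/-- [folklore] On the closed unit disc the terms are dominated by `‖c_{n+1}‖`. -/
theorem norm_term_le {z : ℂ} (hz : ‖z‖ ≤ 1) (n : ℕ) : ‖mayerCoeff inc w (n + 1) * z ^ (n + 1)‖ ≤ ‖mayerCoeff inc w (n + 1)‖ := by
  rw [norm_mul, norm_pow]
  exact mul_le_of_le_one_right (norm_nonneg _) (pow_le_one₀ (norm_nonneg _) hz)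

/-- [folklore] `F` is continuous on the closed unit disc (uniform convergence). -/
theorem continuousOn_mayerF (h : Summable fun n => Uabs inc w (n + 1) / ((n + 1).factorial : ℝ)) : ContinuousOn (mayerF inc w) (Metric.closedBall 0 1) := by
  unfold mayerF
  refine continuousOn_tsum (fun n => ?_) (summable_norm_mayerCoeff h) fun n z hz => norm_term_le ?_ n
  · fun_prop
  · simpa using hz

/-- [folklore] `F` is holomorphic on the open unit disc. -/
theorem differentiableOn_mayerF (h : Summable fun n => Uabs inc w (n + 1) / ((n + 1).factorial : ℝ)) : DifferentiableOn ℂ (mayerF inc w) (Metric.ball 0 1) := by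
  unfold mayerF
  refine Complex.differentiableOn_tsum_of_summable_norm (summable_norm_mayerCoeff h) (fun n => ?_) Metric.isOpen_ball
    fun n z hz => norm_term_le ?_ n
  · fun_prop
  · exact le_of_lt (by simpa using hz)

/-- [folklore] TERMWISE DERIVATIVE inside the disc: `Σ_n c_{n+1}·(n+1)·z^n` sums to `F′(z)`. -/
theorem hasSum_deriv_mayerF (h : Summable fun n => Uabs inc w (n + 1) / ((n + 1).factorial : ℝ)) {z : ℂ} (hz : z ∈ Metric.ball (0 : ℂ) 1) :
    HasSum (fun n => mayerCoeff inc w (n + 1) * (((n : ℂ) + 1) * z ^ n)) (deriv (mayerF inc w) z) := by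
  have hsum := Complex.hasSum_deriv_of_summable_norm (F := fun n z => mayerCoeff inc w (n + 1) * z ^ (n + 1))
    (summable_norm_mayerCoeff h) (fun n => by fun_prop) Metric.isOpen_ball (fun n z hz => norm_term_le
      (le_of_lt (by simpa using hz)) n) hz
  have hderiv : ∀ n, deriv (fun z => mayerCoeff inc w (n + 1) * z ^ (n + 1)) z =
      mayerCoeff inc w (n + 1) * (((n : ℂ) + 1) * z ^ n) := by
    intro n
    rw [((hasDerivAt_pow (n + 1) z).const_mul (mayerCoeff inc w (n + 1))).deriv]
    push_cast
    simp
  simp only [hderiv] at hsum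
  exact hsum

/-! ## §2 `Z′ = F′·Z` along the ray on `[0, 1)` -/

/-- [folklore] For `0 ≤ s < 1`, eventually `(n+1)·s^n ≤ 1`. -/
theorem eventually_succ_mul_pow_le_one {s : ℝ} (hs0 : 0 ≤ s) (hs1 : s < 1) :
    ∀ᶠ n : ℕ in atTop, ((n : ℝ) + 1) * s ^ n ≤ 1 := by
  have h1 : Tendsto (fun n : ℕ => (n : ℝ) * s ^ n) atTop (𝓝 0) := tendsto_self_mul_const_pow_of_lt_one hs0 hs1
  have h2 : Tendsto (fun n : ℕ => s ^ n) atTop (𝓝 0) := tendsto_pow_atTop_nhds_zero_of_lt_one hs0 hs1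
  have h : Tendsto (fun n : ℕ => ((n : ℝ) + 1) * s ^ n) atTop (𝓝 0) := by
    have := h1.add h2
    simp only [add_zero] at this
    refine this.congr fun n => ?_
    ring
  exact ((tendsto_order.1 h).2 1 zero_lt_one).mono fun n hn => hn.le

/-- [folklore] At a real point of `[0, 1)` the derivative series converges ABSOLUTELY. -/
theorem summable_norm_deriv_terms (h : Summable fun n => Uabs inc w (n + 1) / ((n + 1).factorial : ℝ)) {s : ℝ} (hs0 : 0 ≤ s) (hs1 : s < 1) :
    Summable fun n => ‖mayerCoeff inc w (n + 1) * ((((n : ℂ) + 1) * (s : ℂ) ^ n))‖ := by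
  refine Summable.of_norm_bounded_eventually_nat (g := fun n => ‖mayerCoeff inc w (n + 1)‖) (summable_norm_mayerCoeff h) ?_
  filter_upwards [eventually_succ_mul_pow_le_one hs0 hs1] with n hn
  rw [norm_norm, norm_mul]
  refine mul_le_of_le_one_right (norm_nonneg _) ?_
  have : ‖((n : ℂ) + 1) * (s : ℂ) ^ n‖ = ((n : ℝ) + 1) * s ^ n := by
    rw [norm_mul, norm_pow, Complex.norm_real, Real.norm_eq_abs, abs_of_nonneg hs0]
    congr 1
    have : ((n : ℂ) + 1) = ((n + 1 : ℕ) : ℂ) := by push_cast; ring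
    rw [this, Complex.norm_natCast]
    push_cast; ring
  rw [this]
  exact hn

/-- [folklore] **`F′(s)·Z(s•w) = Z′(s)` for `s ∈ [0,1)`** (reflexive symmetric hard core): the Cauchy product of the derivative
series and the finite partition function, whose coefficients are the convolution identity `succ_mul_zc_succ`. -/
theorem deriv_mayerF_mul_Z [DecidableEq β] (hrefl : ∀ a, inc a a) (hsymm : ∀ a b, inc a b → inc b a) (h : Summable fun n => Uabs inc w (n + 1) / ((n + 1).factorial : ℝ))
    {s : ℝ} (hs0 : 0 ≤ s) (hs1 : s < 1) :
    deriv (mayerF inc w) s * polymerPartitionFunction inc (fun γ => (s : ℂ) * w γ) univ = polymerRayDeriv inc w univ s := by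
  classical
  set N := Fintype.card β with hN
  have hz : (s : ℂ) ∈ Metric.ball (0 : ℂ) 1 := by
    simpa [abs_of_nonneg hs0] using hs1
  -- the two factors as `tsum`s
  set f : ℕ → ℂ := fun n => mayerCoeff inc w (n + 1) * (((n : ℂ) + 1) * (s : ℂ) ^ n) with hf
  set g : ℕ → ℂ := fun n => zc inc w n * (s : ℂ) ^ n with hg
  have hfsum : ∑' n, f n = deriv (mayerF inc w) s := (hasSum_deriv_mayerF h hz).tsum_eq
  have hgsupp : ∀ n ∉ Finset.range (N + 1), g n = 0 := by
    intro n hn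
    rw [hg]
    simp only
    rw [zc_eq_zero_of_lt inc w (by simpa [hN] using hn), zero_mul]
  have hgsum : ∑' n, g n = polymerPartitionFunction inc (fun γ => (s : ℂ) * w γ) univ := by
    rw [tsum_eq_sum hgsupp, polymerPartitionFunction_ray_eq_sum_zc]
  have hfnorm : Summable fun n => ‖f n‖ := summable_norm_deriv_terms h hs0 hs1
  have hgnorm : Summable fun n => ‖g n‖ :=
    summable_of_ne_finset_zero (s := Finset.range (N + 1)) fun n hn => by rw [hgsupp n hn, norm_zero]
  rw [← hfsum, ← hgsum, tsum_mul_tsum_eq_tsum_sum_antidiagonal_of_summable_norm hfnorm hgnorm]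
  -- the antidiagonal sums are the convolution identity
  have hanti : ∀ n, ∑ kl ∈ antidiagonal n, f kl.1 * g kl.2 = ((n : ℂ) + 1) * zc inc w (n + 1) * (s : ℂ) ^ n := by
    intro n
    rw [Finset.Nat.sum_antidiagonal_eq_sum_range_succ_mk, succ_mul_zc_succ inc w hrefl hsymm n, Finset.sum_mul]
    refine Finset.sum_congr rfl fun p hp => ?_
    have hpn : p ≤ n := Nat.lt_succ_iff.1 (Finset.mem_range.1 hp)
    simp only [hf, hg, mayerCoeff]
    have hfac : ((p + 1).factorial : ℂ) = ((p : ℂ) + 1) * (p.factorial : ℂ) := by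
      rw [Nat.factorial_succ]; push_cast; ring
    have hp0 : (p.factorial : ℂ) ≠ 0 := by exact_mod_cast (Nat.factorial_pos p).ne'
    have hp1 : ((p : ℂ) + 1) ≠ 0 := by exact_mod_cast Nat.succ_ne_zero p
    have hspow : (s : ℂ) ^ n = (s : ℂ) ^ p * (s : ℂ) ^ (n - p) := by rw [← pow_add, Nat.add_sub_cancel' hpn]
    rw [hfac, hspow]
    field_simp
  rw [tsum_congr hanti]
  -- a finitely supported series: levels `n + 1 ≤ N`
  have hsupp : ∀ n ∉ Finset.range N, ((n : ℂ) + 1) * zc inc w (n + 1) * (s : ℂ) ^ n = 0 := by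
    intro n hn
    rw [zc_eq_zero_of_lt inc w (by simpa [hN] using hn), mul_zero, zero_mul]
  rw [tsum_eq_sum hsupp, polymerRayDeriv_eq_sum_zc, Finset.sum_range_succ']
  simp only [Nat.cast_zero, zero_mul, add_zero, Nat.cast_add, Nat.cast_one, Nat.add_sub_cancel]
  rfl

/-! ## §3 `exp F = Z` on the segment and Mayer's theorem -/

/-- [folklore] The real ray `s ↦ F(s)` is continuous on `[0,1]`. -/
theorem continuousOn_mayerF_ofReal (h : Summable fun n => Uabs inc w (n + 1) / ((n + 1).factorial : ℝ)) :
    ContinuousOn (fun s : ℝ => mayerF inc w (s : ℂ)) (Set.Icc 0 1) := by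
  refine (continuousOn_mayerF h).comp Complex.continuous_ofReal.continuousOn fun s hs => ?_
  simpa [abs_le] using And.intro (by linarith [hs.1]) hs.2

/-- [folklore] The real ray `s ↦ F(s)` is differentiable on `[0,1)` with derivative `F′(s)`. -/
theorem hasDerivAt_mayerF_ofReal (h : Summable fun n => Uabs inc w (n + 1) / ((n + 1).factorial : ℝ)) {s : ℝ} (hs0 : 0 ≤ s) (hs1 : s < 1) :
    HasDerivAt (fun s : ℝ => mayerF inc w (s : ℂ)) (deriv (mayerF inc w) s) s := by
  have hz : (s : ℂ) ∈ Metric.ball (0 : ℂ) 1 := by simpa [abs_of_nonneg hs0] using hs1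
  exact ((differentiableOn_mayerF h).differentiableAt (Metric.isOpen_ball.mem_nhds hz)).hasDerivAt.comp_ofReal

/-- [folklore] **`exp(F(t)) = Z(univ; t•w)` on `t ∈ [0,1]`** (reflexive symmetric hard core, absolutely convergent ordered series): the function
`exp(−F)·Z` has zero right derivative on `[0,1)` by §2, is continuous on `[0,1]`, and equals `1` at `0`. -/
theorem cexp_mayerF_eq_polymerPartitionFunction [DecidableEq β] (hrefl : ∀ a, inc a a) (hsymm : ∀ a b, inc a b → inc b a)
    (h : Summable fun n => Uabs inc w (n + 1) / ((n + 1).factorial : ℝ)) {t : ℝ} (ht : t ∈ Set.Icc (0 : ℝ) 1) :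
    Complex.exp (mayerF inc w t) = polymerPartitionFunction inc (fun γ => (t : ℂ) * w γ) univ := by
  set Z : ℝ → ℂ := fun s => polymerPartitionFunction inc (fun γ => (s : ℂ) * w γ) univ with hZdef
  set F : ℝ → ℂ := fun s => mayerF inc w (s : ℂ) with hFdef
  set H : ℝ → ℂ := fun s => Complex.exp (-F s) * Z s with hH
  have hZd : ∀ s, HasDerivAt Z (polymerRayDeriv inc w univ s) s := hasDerivAt_polymerPartitionFunction_ray w univ
  have hHc : ContinuousOn H (Set.Icc 0 1) :=
    ((continuousOn_mayerF_ofReal h).neg.cexp).mul (continuous_polymerPartitionFunction_ray w univ).continuousOn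
  have hHd : ∀ s ∈ Set.Ico (0 : ℝ) 1, HasDerivWithinAt H 0 (Set.Ici s) s := by
    intro s hs
    have h1 : HasDerivAt (fun s => Complex.exp (-F s)) (Complex.exp (-F s) * -deriv (mayerF inc w) s) s :=
      (hasDerivAt_mayerF_ofReal h hs.1 hs.2).neg.cexp
    have h2 := h1.mul (hZd s)
    refine (h2.congr_deriv ?_).hasDerivWithinAt
    have hkey := deriv_mayerF_mul_Z hrefl hsymm h hs.1 hs.2
    show Complex.exp (-F s) * -deriv (mayerF inc w) s * Z s + Complex.exp (-F s) * polymerRayDeriv inc w univ s = 0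
    rw [← hkey]
    ring
  have hconst := constant_of_has_deriv_right_zero hHc hHd t ht
  have hH0 : H 0 = 1 := by
    simp only [hH, hFdef, hZdef, Complex.ofReal_zero, mayerF_zero, neg_zero, Complex.exp_zero, one_mul]
    exact polymerPartitionFunction_zero_mul w univ
  rw [hH0] at hconst
  -- `exp(-F t) * Z t = 1`
  have hconst' : Complex.exp (-F t) * Z t = 1 := hconst
  have hexp : Complex.exp (F t) * (Complex.exp (-F t) * Z t) = Complex.exp (F t) := by rw [hconst', mul_one]
  rw [← mul_assoc, ← Complex.exp_add, add_neg_cancel, Complex.exp_zero, one_mul] at hexp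
  exact hexp.symm

/-- [folklore] Hence the partition function does not vanish along the segment `t•w`, `t ∈ [0,1]`. -/
theorem polymerPartitionFunction_ray_ne_zero [DecidableEq β] (hrefl : ∀ a, inc a a) (hsymm : ∀ a b, inc a b → inc b a)
    (h : Summable fun n => Uabs inc w (n + 1) / ((n + 1).factorial : ℝ)) {t : ℝ} (ht : t ∈ Set.Icc (0 : ℝ) 1) :
    polymerPartitionFunction inc (fun γ => (t : ℂ) * w γ) univ ≠ 0 := by
  rw [← cexp_mayerF_eq_polymerPartitionFunction hrefl hsymm h ht]
  exact Complex.exp_ne_zero _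

/-- [folklore] **MAYER'S THEOREM (finite polymer type).**  For a reflexive symmetric hard core and activities whose ordered
Ursell series converges absolutely, the Kotecký–Preiss logarithm of the partition function of ALL polymers is the Mayer function at
`1`: `polymerLogZ inc w univ = F(1)` (FTC for `F` along `[0,1]`, `F′ = Z′∕Z` by §2–§3). -/
theorem polymerLogZ_eq_mayerF_one [DecidableEq β] (hrefl : ∀ a, inc a a) (hsymm : ∀ a b, inc a b → inc b a)
    (h : Summable fun n => Uabs inc w (n + 1) / ((n + 1).factorial : ℝ)) : polymerLogZ inc w univ = mayerF inc w 1 := by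
  have hZ : ∀ t ∈ Set.Icc (0 : ℝ) 1, polymerPartitionFunction inc (fun γ => (t : ℂ) * w γ) univ ≠ 0 :=
    fun t ht => polymerPartitionFunction_ray_ne_zero hrefl hsymm h ht
  have hderiv : ∀ x ∈ Set.Ioo (0 : ℝ) 1, HasDerivAt (fun s : ℝ => mayerF inc w (s : ℂ))
      (polymerRayDeriv inc w univ x / polymerPartitionFunction inc (fun γ => (x : ℂ) * w γ) univ) x := by
    intro x hx
    have hd := hasDerivAt_mayerF_ofReal h hx.1.le hx.2
    have hkey : deriv (mayerF inc w) x = polymerRayDeriv inc w univ x /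
        polymerPartitionFunction inc (fun γ => (x : ℂ) * w γ) univ :=
      eq_div_of_mul_eq (hZ x ⟨hx.1.le, hx.2.le⟩) (deriv_mayerF_mul_Z hrefl hsymm h hx.1.le hx.2)
    rw [← hkey]
    exact hd
  have hint : IntervalIntegrable (fun t : ℝ => polymerRayDeriv inc w univ t /
      polymerPartitionFunction inc (fun γ => (t : ℂ) * w γ) univ) MeasureTheory.volume 0 1 :=
    (continuousOn_polymerLogZ_integrand hZ).intervalIntegrable
  have hftc := intervalIntegral.integral_eq_sub_of_hasDerivAt_of_le zero_le_one (continuousOn_mayerF_ofReal h) hderiv hint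
  unfold polymerLogZ
  rw [hftc]
  simp [mayerF_zero]

/-- [folklore] **MAYER'S THEOREM, series form**: `polymerLogZ inc w univ = Σ' n, U (n+1) ∕ (n+1)!`. -/
theorem polymerLogZ_eq_tsum [DecidableEq β] (hrefl : ∀ a, inc a a) (hsymm : ∀ a b, inc a b → inc b a)
    (h : Summable fun n => Uabs inc w (n + 1) / ((n + 1).factorial : ℝ)) : polymerLogZ inc w univ = ∑' n, U inc w (n + 1) / ((n + 1).factorial : ℂ) := by
  rw [polymerLogZ_eq_mayerF_one hrefl hsymm h, mayerF_one]
  rfl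

/-- [folklore] **MAYER'S THEOREM, `HasSum` form**: the ordered series `Σ_n U (n+1)∕(n+1)!` HAS the sum `polymerLogZ inc w univ`. -/
theorem hasSum_polymerLogZ [DecidableEq β] (hrefl : ∀ a, inc a a) (hsymm : ∀ a b, inc a b → inc b a)
    (h : Summable fun n => Uabs inc w (n + 1) / ((n + 1).factorial : ℝ)) : HasSum (fun n => U inc w (n + 1) / ((n + 1).factorial : ℂ)) (polymerLogZ inc w univ) := by
  rw [polymerLogZ_eq_tsum hrefl hsymm h]
  exact ((summable_norm_mayerCoeff h).of_norm).hasSum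

/-! ## §4 Transport to a finite SET of polymers of an arbitrary type -/

section FinsetTransport

variable {α : Type*} [DecidableEq α] (inc' : α → α → Prop) [DecidableRel inc'] (v : α → ℂ) (K : Finset α)

omit [DecidableEq α] [DecidableRel inc'] in
/-- [folklore] Sums over the tuples of a finite set `K` (as `Fintype.piFinset`) are sums over the tuples of the subtype `↥K`. -/
theorem sum_piFinset_eq_sum_subtype {M : Type*} [AddCommMonoid M] {n : ℕ} (F : (Fin n → α) → M) :
    ∑ Z ∈ Fintype.piFinset (fun _ : Fin n => K), F Z = ∑ Z : Fin n → K, F (fun m => (Z m : α)) := by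
  refine Finset.sum_bij' (fun Z hZ => fun m => ⟨Z m, Fintype.mem_piFinset.1 hZ m⟩) (fun Z _ => fun m => (Z m : α))
    ?_ ?_ ?_ ?_ ?_
  · intro Z hZ; exact Finset.mem_univ _
  · intro Z _; exact Fintype.mem_piFinset.2 fun m => (Z m).2
  · intro Z hZ; rfl
  · intro Z _; rfl
  · intro Z hZ; rfl

/-- [folklore] LEVEL `n` OF THE ORDERED URSELL SERIES OF A FINITE SET `K`: `Σ_{Z ∈ K^{Fin n}} ρᵀ(Z)·Π v(Z m)`. -/
def UK (n : ℕ) : ℂ := ∑ Z ∈ Fintype.piFinset (fun _ : Fin n => K), (ursT inc' Z : ℂ) * ∏ m, v (Z m)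

/-- [folklore] ITS ABSOLUTE VERSION `Σ_{Z ∈ K^{Fin n}} |ρᵀ(Z)|·Π ‖v(Z m)‖`. -/
def UKabs (n : ℕ) : ℝ := ∑ Z ∈ Fintype.piFinset (fun _ : Fin n => K), |(ursT inc' Z : ℝ)| * ∏ m, ‖v (Z m)‖

omit [DecidableEq α] in
/-- [folklore] The absolute level sums of a finite set are nonnegative. -/
theorem UKabs_nonneg (n : ℕ) : 0 ≤ UKabs inc' v K n :=
  Finset.sum_nonneg fun _ _ => mul_nonneg (abs_nonneg _) (Finset.prod_nonneg fun _ _ => norm_nonneg _)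

omit [DecidableEq α] [DecidableRel inc'] in
/-- [folklore] `ρᵀ` of a tuple of members of `K` read in `α` or in the subtype `↥K` is the same integer. -/
theorem ursT_subtype {n : ℕ} (Z : Fin n → K) [DecidableRel inc'] :
    ursT inc' (fun m => (Z m : α)) = ursT (fun a b : K => inc' a b) Z := rfl

omit [DecidableEq α] in
/-- [folklore] The level sums of `K` are the level sums of the finite polymer TYPE `↥K`. -/
theorem UK_eq_U (n : ℕ) : UK inc' v K n = U (fun a b : K => inc' a b) (fun a : K => v a) n := by
  unfold UK U
  rw [sum_piFinset_eq_sum_subtype]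
  rfl

omit [DecidableEq α] in
/-- [folklore] The same for the absolute level sums. -/
theorem UKabs_eq_Uabs (n : ℕ) : UKabs inc' v K n = Uabs (fun a b : K => inc' a b) (fun a : K => v a) n := by
  unfold UKabs Uabs
  rw [sum_piFinset_eq_sum_subtype]
  rfl

/-- [folklore] The Kotecký–Preiss logarithm of `K` is that of the finite polymer type `↥K` (relabelling invariance
`polymerLogZ_image` along the subtype embedding). -/
theorem polymerLogZ_finset_eq_subtype :
    polymerLogZ inc' v K = polymerLogZ (fun a b : K => inc' a b) (fun a : K => v a) univ := by
  have h := polymerLogZ_image (inc := fun a b : K => inc' a b) (inc' := inc') (φ := (Subtype.val : K → α))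
    (w := fun a : K => v a) (w' := v) (Λ := (univ : Finset K)) (Subtype.val_injective.injOn) (fun a _ b _ => Iff.rfl)
    (fun a _ => rfl)
  rw [← h]
  congr 1
  ext a
  simp

/-- [folklore] **MAYER'S THEOREM FOR A FINITE SET OF POLYMERS.**  For a reflexive symmetric hard core `inc'` on `α`, activities `v`,
and a finite set `K` whose ordered Ursell series converges absolutely (`Summable (n ↦ UKabs (n+1) ∕ (n+1)!)`):
`polymerLogZ inc' v K = Σ' n, (1∕(n+1)!)·Σ_{Z ∈ K^{Fin (n+1)}} ρᵀ(Z)·Π v(Z m)`. -/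
theorem polymerLogZ_finset_eq_tsum (hrefl : ∀ a, inc' a a) (hsymm : ∀ a b, inc' a b → inc' b a)
    (h : Summable fun n => UKabs inc' v K (n + 1) / ((n + 1).factorial : ℝ)) :
    polymerLogZ inc' v K = ∑' n, UK inc' v K (n + 1) / ((n + 1).factorial : ℂ) := by
  have h' : Summable fun n => Uabs (fun a b : K => inc' a b) (fun a : K => v a) (n + 1) / ((n + 1).factorial : ℝ) := by
    simpa only [UKabs_eq_Uabs] using h
  rw [polymerLogZ_finset_eq_subtype, polymerLogZ_eq_tsum (inc := fun a b : K => inc' a b) (w := fun a : K => v a)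
    (fun a => hrefl a) (fun a b hab => hsymm a b hab) h']
  exact tsum_congr fun n => by rw [UK_eq_U]

/-- [folklore] `HasSum` form of Mayer's theorem for a finite set of polymers. -/
theorem hasSum_polymerLogZ_finset (hrefl : ∀ a, inc' a a) (hsymm : ∀ a b, inc' a b → inc' b a)
    (h : Summable fun n => UKabs inc' v K (n + 1) / ((n + 1).factorial : ℝ)) :
    HasSum (fun n => UK inc' v K (n + 1) / ((n + 1).factorial : ℂ)) (polymerLogZ inc' v K) := by
  have h' : Summable fun n => Uabs (fun a b : K => inc' a b) (fun a : K => v a) (n + 1) / ((n + 1).factorial : ℝ) := by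
    simpa only [UKabs_eq_Uabs] using h
  rw [polymerLogZ_finset_eq_subtype]
  have hs := hasSum_polymerLogZ (inc := fun a b : K => inc' a b) (w := fun a : K => v a) (fun a => hrefl a)
    (fun a b hab => hsymm a b hab) h'
  refine hs.congr_fun fun n => ?_
  rw [UK_eq_U]

omit [DecidableEq α] in
/-- [folklore] The summands of the finite-set Mayer series are dominated by the absolute level sums: `‖UK (n+1)∕(n+1)!‖ ≤ UKabs (n+1)∕(n+1)!`
(so the series of `polymerLogZ_finset_eq_tsum` converges absolutely under its hypothesis). -/
theorem norm_UK_div_le (n : ℕ) :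
    ‖UK inc' v K (n + 1) / ((n + 1).factorial : ℂ)‖ ≤ UKabs inc' v K (n + 1) / ((n + 1).factorial : ℝ) := by
  rw [UK_eq_U, UKabs_eq_Uabs, norm_div, Complex.norm_natCast]
  exact div_le_div_of_nonneg_right (norm_U_le_Uabs _ _ _) (Nat.cast_nonneg _)

end FinsetTransport

end Summit.QuantumFields.BalabanUV.T4Continuum.UrsellMayerSeries

end
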